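import Summits.AnomalousDissipation.AnomalousDissipation.Theses.TaylorCertificates

/-!
# Sketch — crux-ideate stmt-AnomalousDissipation-14183 (`KolmogorovFloorEnsembleCeiling`), round 1, ideator 2

Idea card `ceiling-slack-soft-floor` ("spend the ceiling on the floor"): the ensemble ceiling the
conjunction already carries is used as an S-procedure multiplier `lam ≥ 0` for the floor, so the floor
inequality may degrade quadratically with the energy of the state:
`ε₀ ≤ D + ⟨F_ν(u),Φ₁'(u)⟩ + 2θ₁P + lam‖u‖²`. Time-averaging along a Leray–Hopf flow from rest gives
`meanDissipation ≥ ε₀ − lam·meanEnergy ≥ ε₀ − lam·E > 0` once `lam·E < ε₀`.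

Contents (all over the LIVE route decls):
* `SoftFloorAt`, `CeilingAt`, `KolmogorovSoftFloorEnsembleCeiling` — the re-cut successor statement
  (differs from the crux by the single summand `lam * ‖u‖ ^ 2` and the side condition `lam * E < ε₀`);
* `pair_imp_soft : KolmogorovFloorEnsembleCeiling → KolmogorovSoftFloorEnsembleCeiling` (λ := 0), PROVED;
* `SoftFloorTransfer` — FIRST LEMMA of the line (provable now, M): the pathwise transfer of a soft floor;
* `softFloorTransfer_of_zero` — sanity: at `lam = 0` it is exactly the route's `FloorTransfer`, PROVED;
* `closes_soft : KolmogorovSoftFloorEnsembleCeiling → SoftFloorTransfer → EnsembleCeilingTransfer →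
   ZeroDatumLerayHopf → AnomalousDissipation`, PROVED (pure logic, same skeleton as the route's `closes`).
-/

noncomputable section

set_option linter.dupNamespace false

open MeasureTheory Filter

namespace Summit.AnomalousDissipation.AnomalousDissipation.Cruxes.KolmogorovFloorEnsembleCeiling.CeilingSlack

open Summit.AnomalousDissipation.AnomalousDissipation.Theses.TaylorCertificates

/-- The SOFT Kolmogorov-class floor datum of the force `f` at one viscosity `ν`: verbatim the floor block
of the crux with one extra summand `lam * ‖u‖ ^ 2` on the right (the Lagrange multiplier of the ceiling
constraint `⟨‖u‖²⟩ ≤ E`). At `lam = 0` it is the crux's block. -/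
def SoftFloorAt (f : UnitAddTorus (Fin 3) → EuclideanSpace ℝ (Fin 3)) (ν ε₀ C Θ lam : ℝ) : Prop :=
  ∃ (N : ℕ) (Φ₁ : Literature.Analysis.FluidPDE.Torus.CylindricalTest (Fin 3)) (θ₁ : ℝ),
    (N : ℝ) ≤ C * ν ^ (-(3 / 4 : ℝ)) ∧
    (∀ i, Literature.Analysis.FunctionSpaces.Torus.fourierTruncate N (Φ₁.g i) = Φ₁.g i) ∧
    -Θ ≤ θ₁ ∧ θ₁ ≤ 0 ∧
    ∀ u : Literature.Analysis.FunctionSpaces.Torus.energySpace (Fin 3),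
      let uf : UnitAddTorus (Fin 3) → EuclideanSpace ℝ (Fin 3) :=
        ((u : MeasureTheory.Lp (EuclideanSpace ℝ (Fin 3)) 2
          (MeasureTheory.volume : MeasureTheory.Measure (UnitAddTorus (Fin 3)))) :
            UnitAddTorus (Fin 3) → EuclideanSpace ℝ (Fin 3))
      let D : ℝ := ν * (Literature.Analysis.FunctionSpaces.Torus.eGradNormSq uf).toReal
      let P : ℝ := Literature.Analysis.FluidPDE.Torus.pairing
        (u : MeasureTheory.Lp (EuclideanSpace ℝ (Fin 3)) 2
          (MeasureTheory.volume : MeasureTheory.Measure (UnitAddTorus (Fin 3)))) f - D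
      Literature.Analysis.FunctionSpaces.Torus.eGradNormSq uf ≠ ⊤ →
        ‖u‖ ^ 2 ≤ 16 * (∫ x, ‖f x‖ ^ 2) / ν ^ 2 →
          ε₀ ≤ D + Literature.Analysis.FluidPDE.Torus.nsGeneratorPairing ν f u (Φ₁.grad u) +
            2 * θ₁ * P + lam * ‖u‖ ^ 2

/-- The ensemble ceiling of `f` at one viscosity (verbatim the ceiling block of the crux). -/
def CeilingAt (f : UnitAddTorus (Fin 3) → EuclideanSpace ℝ (Fin 3)) (ν E : ℝ) : Prop :=
  ∀ μ : MeasureTheory.Measure (Literature.Analysis.FunctionSpaces.Torus.energySpace (Fin 3)),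
    Literature.Analysis.FluidPDE.Torus.IsStationaryStatisticalSolution ν f μ →
      MeasureTheory.Integrable
        (fun v : Literature.Analysis.FunctionSpaces.Torus.energySpace (Fin 3) => ‖v‖ ^ 2) μ →
        Literature.Analysis.FluidPDE.Torus.ensembleEnergy μ ≤ E

/-- THE RE-CUT SUCCESSOR of the crux: one force carrying a SOFT Kolmogorov-class floor with ceiling
multiplier `lam ≥ 0`, `lam * E < ε₀`, and the ensemble ceiling `E`. -/
def KolmogorovSoftFloorEnsembleCeiling : Prop :=
  ∃ f : UnitAddTorus (Fin 3) → EuclideanSpace ℝ (Fin 3),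
    Literature.Analysis.FunctionSpaces.Torus.IsSmooth f ∧
    Literature.Analysis.FunctionSpaces.Torus.IsDivFree f ∧
    Literature.Analysis.FunctionSpaces.Torus.HasZeroMean f ∧
    ∃ (ε₀ C Θ E ν₀ lam : ℝ), 0 < ε₀ ∧ 0 < ν₀ ∧ 0 ≤ lam ∧ lam * E < ε₀ ∧
      ∀ ν : ℝ, 0 < ν → ν < ν₀ → SoftFloorAt f ν ε₀ C Θ lam ∧ CeilingAt f ν E

/-- The crux implies its soft re-cut (`lam := 0`). -/
theorem pair_imp_soft : KolmogorovFloorEnsembleCeiling → KolmogorovSoftFloorEnsembleCeiling := by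
  intro h
  obtain ⟨f, hfs, hfd, hfz, ε₀, C, Θ, E, ν₀, hε₀, hν₀, h⟩ := h
  refine ⟨f, hfs, hfd, hfz, ε₀, C, Θ, E, ν₀, 0, hε₀, hν₀, le_rfl, by simpa using hε₀, fun ν hν hνlt => ?_⟩
  obtain ⟨⟨N, Φ₁, θ₁, hN, hband, hΘ, hθ₁, hfloor⟩, hceil⟩ := h ν hν hνlt
  refine ⟨⟨N, Φ₁, θ₁, hN, hband, hΘ, hθ₁, fun u => ?_⟩, hceil⟩
  intro uf D P hfin hball
  have h' := hfloor u hfin hball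
  simp only [zero_mul, add_zero]
  exact h'

/-- FIRST LEMMA of the line (provable now, M-sized): pathwise transfer of a SOFT floor. For `ν > 0`,
`f` smooth, `θ₁ ≤ 0`, `lam ≥ 0`, a soft floor valid on the finite-enstrophy part of the ball
`{‖v‖² ≤ ρ}`, and a global Leray–Hopf `u` (datum `u₀`) whose `H`-lift `U` stays in that ball:
`ε₀ ≤ meanDissipation ν u + lam * meanEnergy u`. Proof (as the route's `FloorTransfer` plus one
term): integrate the floor along `U` on `[0,T]`; `∫⟨F(U),Φ₁'(U)⟩ = Φ₁(U T) − Φ₁(U 0)` is bounded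
(`IsGlobalLerayHopf.cylindrical_eval_sub_eq_integral`, `CylindricalTest.exists_abs_eval_le`);
`2θ₁∫((f,u) − D) ≤ |θ₁|‖u₀‖²` (energy inequality from `0`, sign of `θ₁`); hence
`T⁻¹∫₀ᵀ D ≥ ε₀ − lam·T⁻¹∫₀ᵀ‖U‖² − c/T`, so `liminf_T T⁻¹∫₀ᵀ D ≥ ε₀ − lam·limsup_T T⁻¹∫₀ᵀ‖U‖²`
(`lam ≥ 0`), and `limsup ≥ liminf` (Cesàro means bounded: `T⁻¹∫₀ᵀ D ≤ ‖u₀‖²/(2T) + ‖f‖√ρ`). -/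
def SoftFloorTransfer : Prop :=
  ∀ (ν ε₀ ρ θ₁ lam : ℝ) (f u₀ : UnitAddTorus (Fin 3) → EuclideanSpace ℝ (Fin 3))
    (u : ℝ → UnitAddTorus (Fin 3) → EuclideanSpace ℝ (Fin 3))
    (U : ℝ → Literature.Analysis.FunctionSpaces.Torus.energySpace (Fin 3))
    (Φ₁ : Literature.Analysis.FluidPDE.Torus.CylindricalTest (Fin 3)),
    0 < ν → Literature.Analysis.FunctionSpaces.Torus.IsSmooth f → θ₁ ≤ 0 → 0 ≤ lam →
    (∀ v : Literature.Analysis.FunctionSpaces.Torus.energySpace (Fin 3),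
      let vf : UnitAddTorus (Fin 3) → EuclideanSpace ℝ (Fin 3) :=
        ((v : MeasureTheory.Lp (EuclideanSpace ℝ (Fin 3)) 2
          (MeasureTheory.volume : MeasureTheory.Measure (UnitAddTorus (Fin 3)))) :
            UnitAddTorus (Fin 3) → EuclideanSpace ℝ (Fin 3))
      let D : ℝ := ν * (Literature.Analysis.FunctionSpaces.Torus.eGradNormSq vf).toReal
      let P : ℝ := Literature.Analysis.FluidPDE.Torus.pairing
        (v : MeasureTheory.Lp (EuclideanSpace ℝ (Fin 3)) 2
          (MeasureTheory.volume : MeasureTheory.Measure (UnitAddTorus (Fin 3)))) f - D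
      Literature.Analysis.FunctionSpaces.Torus.eGradNormSq vf ≠ ⊤ → ‖v‖ ^ 2 ≤ ρ →
        ε₀ ≤ D + Literature.Analysis.FluidPDE.Torus.nsGeneratorPairing ν f v (Φ₁.grad v) +
          2 * θ₁ * P + lam * ‖v‖ ^ 2) →
    Literature.Analysis.FluidPDE.Torus.IsGlobalLerayHopf ν (fun _ => f) u₀ u →
    (∀ t, 0 ≤ t →
      ((U t : MeasureTheory.Lp (EuclideanSpace ℝ (Fin 3)) 2
        (MeasureTheory.volume : MeasureTheory.Measure (UnitAddTorus (Fin 3)))) :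
          UnitAddTorus (Fin 3) → EuclideanSpace ℝ (Fin 3)) =ᵐ[MeasureTheory.volume] u t) →
    (∀ t, 0 ≤ t → ‖U t‖ ^ 2 ≤ ρ) →
    ε₀ ≤ Literature.Analysis.FluidPDE.meanDissipation ν u +
      lam * Literature.Analysis.FluidPDE.meanEnergy u

/-- Sanity: at `lam = 0` the soft transfer is literally the route's `FloorTransfer` (support item
stmt-14087, vetted provable-now). -/
theorem softFloorTransfer_zero_of_floorTransfer (hF : FloorTransfer) :
    ∀ (ν ε₀ ρ θ₁ : ℝ) (f u₀ : UnitAddTorus (Fin 3) → EuclideanSpace ℝ (Fin 3))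
      (u : ℝ → UnitAddTorus (Fin 3) → EuclideanSpace ℝ (Fin 3))
      (U : ℝ → Literature.Analysis.FunctionSpaces.Torus.energySpace (Fin 3))
      (Φ₁ : Literature.Analysis.FluidPDE.Torus.CylindricalTest (Fin 3)),
      0 < ν → Literature.Analysis.FunctionSpaces.Torus.IsSmooth f → θ₁ ≤ 0 →
      (∀ v : Literature.Analysis.FunctionSpaces.Torus.energySpace (Fin 3),
        let vf : UnitAddTorus (Fin 3) → EuclideanSpace ℝ (Fin 3) :=
          ((v : MeasureTheory.Lp (EuclideanSpace ℝ (Fin 3)) 2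
            (MeasureTheory.volume : MeasureTheory.Measure (UnitAddTorus (Fin 3)))) :
              UnitAddTorus (Fin 3) → EuclideanSpace ℝ (Fin 3))
        let D : ℝ := ν * (Literature.Analysis.FunctionSpaces.Torus.eGradNormSq vf).toReal
        let P : ℝ := Literature.Analysis.FluidPDE.Torus.pairing
          (v : MeasureTheory.Lp (EuclideanSpace ℝ (Fin 3)) 2
            (MeasureTheory.volume : MeasureTheory.Measure (UnitAddTorus (Fin 3)))) f - D
        Literature.Analysis.FunctionSpaces.Torus.eGradNormSq vf ≠ ⊤ → ‖v‖ ^ 2 ≤ ρ →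
          ε₀ ≤ D + Literature.Analysis.FluidPDE.Torus.nsGeneratorPairing ν f v (Φ₁.grad v) +
            2 * θ₁ * P + 0 * ‖v‖ ^ 2) →
      Literature.Analysis.FluidPDE.Torus.IsGlobalLerayHopf ν (fun _ => f) u₀ u →
      (∀ t, 0 ≤ t →
        ((U t : MeasureTheory.Lp (EuclideanSpace ℝ (Fin 3)) 2
          (MeasureTheory.volume : MeasureTheory.Measure (UnitAddTorus (Fin 3)))) :
            UnitAddTorus (Fin 3) → EuclideanSpace ℝ (Fin 3)) =ᵐ[MeasureTheory.volume] u t) →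
      (∀ t, 0 ≤ t → ‖U t‖ ^ 2 ≤ ρ) →
      ε₀ ≤ Literature.Analysis.FluidPDE.meanDissipation ν u +
        0 * Literature.Analysis.FluidPDE.meanEnergy u := by
  intro ν ε₀ ρ θ₁ f u₀ u U Φ₁ hν hfs hθ₁ hfloor hLH hU hball
  have hfloor' : ∀ v : Literature.Analysis.FunctionSpaces.Torus.energySpace (Fin 3),
      let vf : UnitAddTorus (Fin 3) → EuclideanSpace ℝ (Fin 3) :=
        ((v : MeasureTheory.Lp (EuclideanSpace ℝ (Fin 3)) 2
          (MeasureTheory.volume : MeasureTheory.Measure (UnitAddTorus (Fin 3)))) :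
            UnitAddTorus (Fin 3) → EuclideanSpace ℝ (Fin 3))
      let D : ℝ := ν * (Literature.Analysis.FunctionSpaces.Torus.eGradNormSq vf).toReal
      let P : ℝ := Literature.Analysis.FluidPDE.Torus.pairing
        (v : MeasureTheory.Lp (EuclideanSpace ℝ (Fin 3)) 2
          (MeasureTheory.volume : MeasureTheory.Measure (UnitAddTorus (Fin 3)))) f - D
      Literature.Analysis.FunctionSpaces.Torus.eGradNormSq vf ≠ ⊤ → ‖v‖ ^ 2 ≤ ρ →
        ε₀ ≤ D + Literature.Analysis.FluidPDE.Torus.nsGeneratorPairing ν f v (Φ₁.grad v) +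
          2 * θ₁ * P := by
    intro v
    have := hfloor v
    simpa using this
  have := hF ν ε₀ ρ θ₁ f u₀ u U Φ₁ hν hfs hθ₁ hfloor' hLH hU hball
  simpa using this

/-- DECIDING THEOREM of the re-cut (pure logic; the skeleton of the route's `closes` with the floor
`ε := ε₀ − lam·E > 0`): along `ν_j = ν₀/(j+2)`, Hopf from rest inside the Leray ball
(`ZeroDatumLerayHopf`), the soft transfer (`ρ = 16‖f‖₂²/ν²`) and the ceiling transfer give
`meanDissipation ≥ ε₀ − lam·meanEnergy ≥ ε₀ − lam·E` and `meanEnergy ≤ E` for every `j`. -/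
theorem closes_soft : KolmogorovSoftFloorEnsembleCeiling → SoftFloorTransfer → EnsembleCeilingTransfer →
    ZeroDatumLerayHopf → _root_.AnomalousDissipation := by
  intro hX hF hC hZ
  obtain ⟨f, hfs, hfd, hfz, ε₀, C, Θ, E, ν₀, lam, hε₀, hν₀, hlam, hlamE, hcert⟩ := hX
  have key : ∀ j : ℕ, ∃ u : ℝ → UnitAddTorus (Fin 3) → EuclideanSpace ℝ (Fin 3),
      Literature.Analysis.FluidPDE.Torus.IsGlobalLerayHopf (ν₀ / ((j : ℝ) + 2)) (fun _ => f) 0 u ∧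
        ε₀ - lam * E ≤ Literature.Analysis.FluidPDE.meanDissipation (ν₀ / ((j : ℝ) + 2)) u ∧
          Literature.Analysis.FluidPDE.meanEnergy u ≤ E := by
    intro j
    have hj : (0 : ℝ) < (j : ℝ) + 2 := by positivity
    have hνpos : 0 < ν₀ / ((j : ℝ) + 2) := div_pos hν₀ hj
    have hνlt : ν₀ / ((j : ℝ) + 2) < ν₀ := by
      rw [div_lt_iff₀ hj]
      nlinarith
    obtain ⟨⟨N, Φ₁, θ₁, -, -, -, hθ₁, hfloor⟩, hceil⟩ := hcert _ hνpos hνlt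
    obtain ⟨u, U, hLH, hU, hball⟩ := hZ _ f hνpos hfs hfz
    have hE : Literature.Analysis.FluidPDE.meanEnergy u ≤ E :=
      hC _ E _ f 0 u U hνpos hfs hfd hfz hceil hLH hU hball
    have hD : ε₀ ≤ Literature.Analysis.FluidPDE.meanDissipation (ν₀ / ((j : ℝ) + 2)) u +
        lam * Literature.Analysis.FluidPDE.meanEnergy u :=
      hF _ ε₀ _ θ₁ lam f 0 u U Φ₁ hνpos hfs hθ₁ hlam hfloor hLH hU hball
    have hmul : lam * Literature.Analysis.FluidPDE.meanEnergy u ≤ lam * E :=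
      mul_le_mul_of_nonneg_left hE hlam
    exact ⟨u, hLH, by linarith, hE⟩
  choose u hu using key
  refine ⟨f, hfs, hfd, hfz, fun j => ν₀ / ((j : ℝ) + 2), fun _ => 0, u,
    fun j => div_pos hν₀ (by positivity), ?_, fun j => (hu j).1, ⟨E, fun j => (hu j).2.2⟩,
    ε₀ - lam * E, by linarith, fun j => (hu j).2.1⟩
  have h1 : Filter.Tendsto (fun j : ℕ => ((j : ℝ) + 2)⁻¹) Filter.atTop (nhds 0) :=
    tendsto_inv_atTop_zero.comp
      (Filter.tendsto_atTop_add_const_right Filter.atTop (2 : ℝ) tendsto_natCast_atTop_atTop)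
  have h2 : Filter.Tendsto (fun j : ℕ => ν₀ * ((j : ℝ) + 2)⁻¹) Filter.atTop (nhds (ν₀ * 0)) :=
    h1.const_mul ν₀
  rw [mul_zero] at h2
  simpa [div_eq_mul_inv] using h2

/-- The soft re-cut also projects onto the route's ceiling crux shape for the same force
(bookkeeping: the ceiling block is untouched). -/
theorem soft_imp_ceilingAt {f : UnitAddTorus (Fin 3) → EuclideanSpace ℝ (Fin 3)} {ν ε₀ C Θ lam E : ℝ}
    (h : SoftFloorAt f ν ε₀ C Θ lam ∧ CeilingAt f ν E) : CeilingAt f ν E := h.2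

end Summit.AnomalousDissipation.AnomalousDissipation.Cruxes.KolmogorovFloorEnsembleCeiling.CeilingSlack
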